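import Summits.ABC.ABC.Theorems.DeepRegimeABC.Negative.WithoutEps
import Literature.Barriers.ABC.EpsilonCannotBeDroppedPolylog
import Literature.NumberTheory.DiophantineGeometry.AbcImpliesHall

/-!
# `DeepRegimeABC` (stmt-ABC-15121): polylogarithmic losses fail on every deep cell

Negative-side support lemmas for the crux `Summit.ABC.ABC.Theses.IneffectiveSubspace.DeepRegimeABC`
(crux disprover's work file `Cruxes/DeepRegimeABC/Disproof.lean` §(b), 2026-08-16).
`Negative/WithoutEps.lean`: on every cell `{ω₅(abc) ≥ K}` the exponent `1 + ε` cannot be replaced by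
`1` with a constant loss.  Here the Stewart–Tijdeman pigeonhole (Bombieri–Gubler, Prop. 12.4.12;
whole-set version in `Literature.Barriers.ABC.EpsilonCannotBeDroppedPolylog`) is run INSIDE each deep
cell: the modulus `2^k` becomes `N^{tf}`, `N = 2·p₀⋯p_{K−1}` (so `N⁵ ∣ b` and the triple lies in the
cell), the units being taken over `t = A + 1` primes ABOVE `p_K` (coprime to `N`).

* `exists_triple_of_congruent_units_mod` — the gcd step of B–G 12.4.12 for an arbitrary modulus `m`
  coprime to the unit primes: `rad(abc)·m ≤ P·rad(m)·b`, `m ∣ b`;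
* `exists_triple_mod` — the pigeonhole: `m < L^t` units give such a triple with `c ≤ P^L`;
* `deepCell_polylog_loss` — for every `K`, `A : ℕ`, `C : ℝ` an abc triple with `ω₅(abc) ≥ K`,
  `rad(abc) < c` and `C·rad(abc)·(log c)^A < c`;
* `deepRegimeABC_false_with_polylog_loss` — hence for every real `A` there are no `K`, `C` with
  `c ≤ C·rad(abc)·(log c)^A` on the cell `{ω₅(abc) ≥ K}`: the `ε` of the crux cannot be weakened to
  ANY polylogarithmic loss on ANY deep cell (the cell version of the catalogued barrier
  `Literature.Barriers.ABC.EpsilonCannotBeDropped`, clause `F(N) = (log N)^A`).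
-/

-- `Summit.<Summit>.<Problem>` is the mandated summit-side namespace (CONVENTIONS §2); for the
-- single-conjunct summit `ABC` the two coincide, so the duplicate `ABC.ABC` is deliberate.
set_option linter.dupNamespace false

namespace Summit.ABC.ABC.Theorems.DeepRegimeABC.Negative

open Literature.NumberTheory.DiophantineGeometry UniqueFactorizationMonoid

/-! ### Units over the primes `q_i = p_{i+s}` -/

/-- The units `∏_{i<t} p_{i+s}^{e_i}` are positive. [folklore] -/
theorem prod_nth_prime_add_pow_pos {t s : ℕ} (e : Fin t → ℕ) :
    0 < ∏ i : Fin t, Nat.nth Nat.Prime (i + s) ^ e i :=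
  Finset.prod_pos fun _ _ => pow_pos (Nat.prime_nth_prime _).pos _

/-- `Q = ∏_{i<t} p_{i+s}` is positive. [folklore] -/
theorem prod_nth_prime_add_pos (t s : ℕ) : 0 < ∏ i : Fin t, Nat.nth Nat.Prime (i + s) :=
  Finset.prod_pos fun _ _ => (Nat.prime_nth_prime _).pos

/-- `∏ p_{i+s}^{e_i} ∣ Q^L` when all `e_i ≤ L`. [folklore] -/
theorem prod_nth_prime_add_pow_dvd {t s L : ℕ} (e : Fin t → ℕ) (he : ∀ i, e i ≤ L) :
    (∏ i : Fin t, Nat.nth Nat.Prime (i + s) ^ e i) ∣ (∏ i : Fin t, Nat.nth Nat.Prime (i + s)) ^ L := by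
  rw [← Finset.prod_pow]
  exact Finset.prod_dvd_prod_of_dvd _ _ fun i _ => pow_dvd_pow _ (he i)

/-- Unique factorisation: the exponent of `p_{j+s}` in `∏ p_{i+s}^{e_i}` is `e_j`. [folklore] -/
theorem factorization_prod_nth_prime_add_pow {t s : ℕ} (e : Fin t → ℕ) (j : Fin t) :
    (∏ i : Fin t, Nat.nth Nat.Prime (i + s) ^ e i).factorization (Nat.nth Nat.Prime (j + s)) = e j := by
  rw [Nat.factorization_prod fun (i : Fin t) _ => pow_ne_zero _ (Nat.prime_nth_prime _).ne_zero]
  rw [Finset.sum_apply']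
  simp_rw [(Nat.prime_nth_prime _).factorization_pow, Finsupp.single_apply]
  rw [Finset.sum_eq_single j]
  · simp
  · intro i _ hij
    have : Nat.nth Nat.Prime (i + s) ≠ Nat.nth Nat.Prime (j + s) := fun h =>
      hij (Fin.ext (by simpa using (Nat.nth_injective Nat.infinite_setOf_prime) h))
    simp [this]
  · intro h; exact absurd (Finset.mem_univ j) h

/-- Distinct exponent vectors give distinct units. [folklore] -/
theorem prod_nth_prime_add_pow_injective (t s : ℕ) :
    Function.Injective (fun e : Fin t → ℕ => ∏ i : Fin t, Nat.nth Nat.Prime (i + s) ^ e i) := by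
  intro e e' h
  funext j
  rw [← factorization_prod_nth_prime_add_pow e j, ← factorization_prod_nth_prime_add_pow e' j]
  exact congrArg (fun n : ℕ => n.factorization (Nat.nth Nat.Prime (j + s))) h

/-- The deep modulus base `N = 2·p₀⋯p_{K−1}` is coprime to every prime `p_{i+K+1}` above `p_K`.
[folklore] -/
theorem coprime_deepModulus_nth_prime_add (K i : ℕ) :
    Nat.Coprime (2 * ∏ j ∈ Finset.range K, Nat.nth Nat.Prime j) (Nat.nth Nat.Prime (i + (K + 1))) := by
  have hq : (Nat.nth Nat.Prime (i + (K + 1))).Prime := Nat.prime_nth_prime _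
  rw [Nat.coprime_comm, hq.coprime_iff_not_dvd]
  intro h
  have hinj := Nat.nth_injective Nat.infinite_setOf_prime
  rcases (Nat.Prime.dvd_mul hq).mp h with h2 | hprod
  · -- q ∣ 2 forces q = 2 = p₀
    have h22 := (Nat.prime_dvd_prime_iff_eq hq Nat.prime_two).mp h2
    rw [← Nat.nth_prime_zero_eq_two] at h22
    have := hinj h22
    omega
  · obtain ⟨j, hj, hqj⟩ := (hq.prime.dvd_finsetProd_iff _).mp hprod
    have hqj' := (Nat.prime_dvd_prime_iff_eq hq (Nat.prime_nth_prime j)).mp hqj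
    have := hinj hqj'
    have hjK := Finset.mem_range.mp hj
    omega

/-- Hence `N^e` is coprime to the unit base `Q = ∏_{i<t} p_{i+K+1}`. [folklore] -/
theorem coprime_deepModulus_pow_prod (K t e : ℕ) :
    Nat.Coprime ((2 * ∏ j ∈ Finset.range K, Nat.nth Nat.Prime j) ^ e)
      (∏ i : Fin t, Nat.nth Nat.Prime (i + (K + 1))) :=
  Nat.Coprime.pow_left e (Nat.Coprime.prod_right fun i _ => coprime_deepModulus_nth_prime_add K i)

/-! ### The gcd step and the pigeonhole with a general modulus -/

/-- **Gcd step of Bombieri–Gubler's Prop. 12.4.12 with a general modulus.** If `n < n'` divide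
`P^M`, `n ≡ n' (mod m)` and `m` is coprime to `P`, then `a = n/d`, `b = (n' − n)/d`, `c = n'/d`
(`d = gcd(n,n')`) is an abc triple with `m ∣ b`, `rad(abc)·m ≤ P·rad(m)·b` and `c ≤ P^M`.
[cite: BombieriGubler2006, Prop. 12.4.12] -/
theorem exists_triple_of_congruent_units_mod {P M m n n' : ℕ} (hmP : Nat.Coprime m P)
    (hP0 : 0 < P) (hm0 : 0 < m) (hn : n ∣ P ^ M) (hn' : n' ∣ P ^ M) (hlt : n < n')
    (hmod : n ≡ n' [MOD m]) (hn0 : 0 < n) :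
    ∃ a b c : ℕ, IsABCTriple a b c ∧ rad a b c * m ≤ P * radical m * b ∧ c ≤ P ^ M ∧ m ∣ b := by
  set d := Nat.gcd n n' with hd
  have hd0 : 0 < d := Nat.gcd_pos_of_pos_left _ hn0
  have hdn : d ∣ n := Nat.gcd_dvd_left _ _
  have hdn' : d ∣ n' := Nat.gcd_dvd_right _ _
  set a := n / d with ha
  set c := n' / d with hc
  have hda : d * a = n := Nat.mul_div_cancel' hdn
  have hdc : d * c = n' := Nat.mul_div_cancel' hdn'
  have ha0 : 0 < a := Nat.div_pos (Nat.le_of_dvd hn0 hdn) hd0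
  have hac : a < c := Nat.div_lt_div_of_lt_of_dvd hdn' hlt
  have hcop : Nat.Coprime a c := Nat.coprime_div_gcd_div_gcd hd0
  set b := c - a with hb
  have hb0 : 0 < b := by omega
  have habc : a + b = c := by omega
  have hcopab : Nat.Coprime a b := (Nat.coprime_sub_self_right hac.le).mpr hcop
  -- `m ∣ b`
  have hPM0 : P ^ M ≠ 0 := pow_ne_zero _ hP0.ne'
  have hdvd_sub : m ∣ n' - n := (Nat.modEq_iff_dvd' hlt.le).mp hmod
  have hsub : n' - n = d * b := by
    rw [hb, Nat.mul_sub, hdc, hda]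
  have hcopmd : Nat.Coprime m d :=
    Nat.Coprime.coprime_dvd_right (dvd_trans hdn hn) (Nat.Coprime.pow_right M hmP)
  have hmb : m ∣ b := by
    rw [hsub] at hdvd_sub
    exact hcopmd.dvd_of_dvd_mul_left hdvd_sub
  obtain ⟨b', hb'⟩ := hmb
  have hb'0 : 0 < b' := by
    rcases Nat.eq_zero_or_pos b' with h | h
    · rw [h, mul_zero] at hb'; omega
    · exact h
  -- radical bound: every prime factor of `abc` divides `P * radical m * b'`
  have hradm0 : radical m ≠ 0 := radical_ne_zero
  have hX0 : P * radical m * b' ≠ 0 :=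
    Nat.mul_ne_zero (Nat.mul_ne_zero hP0.ne' hradm0) hb'0.ne'
  have ha_dvd : a ∣ P ^ M := dvd_trans (Nat.div_dvd_of_dvd hdn) hn
  have hc_dvd : c ∣ P ^ M := dvd_trans (Nat.div_dvd_of_dvd hdn') hn'
  have hrad_dvd : radical (a * b * c) ∣ P * radical m * b' := by
    rw [Nat.radical_dvd_iff hX0]
    intro q hq
    rw [Nat.mem_primeFactors] at hq ⊢
    obtain ⟨hqprime, hqdvd, -⟩ := hq
    refine ⟨hqprime, ?_, hX0⟩
    rcases (Nat.Prime.dvd_mul hqprime).mp hqdvd with h | h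
    · rcases (Nat.Prime.dvd_mul hqprime).mp h with h' | h'
      · -- q ∣ a ∣ P^M
        have hqP : q ∣ P := hqprime.dvd_of_dvd_pow (dvd_trans h' ha_dvd)
        exact dvd_mul_of_dvd_left (dvd_mul_of_dvd_left hqP _) _
      · -- q ∣ b = m * b'
        rw [hb'] at h'
        rcases (Nat.Prime.dvd_mul hqprime).mp h' with h'' | h''
        · -- q ∣ m, hence q ∣ radical m
          have hqrad : q ∣ radical m := by
            have hmem : q ∈ m.primeFactors := Nat.mem_primeFactors.mpr ⟨hqprime, h'', hm0.ne'⟩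
            rw [← Nat.primeFactors_radical] at hmem
            exact Nat.dvd_of_mem_primeFactors hmem
          exact dvd_mul_of_dvd_left (dvd_mul_of_dvd_right hqrad _) _
        · exact dvd_mul_of_dvd_right h'' _
    · have hqP : q ∣ P := hqprime.dvd_of_dvd_pow (dvd_trans h hc_dvd)
      exact dvd_mul_of_dvd_left (dvd_mul_of_dvd_left hqP _) _
  have hrad_le : radical (a * b * c) ≤ P * radical m * b' :=
    Nat.le_of_dvd (Nat.pos_of_ne_zero hX0) hrad_dvd
  refine ⟨a, b, c, ⟨ha0, hb0, habc, hcopab⟩, ?_, ?_, ⟨b', hb'⟩⟩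
  · calc rad a b c * m = radical (a * b * c) * m := rfl
      _ ≤ P * radical m * b' * m := Nat.mul_le_mul_right _ hrad_le
      _ = P * radical m * b := by rw [hb']; ring
  · exact le_trans (Nat.div_le_self _ _) (Nat.le_of_dvd (Nat.pos_of_ne_zero hPM0) hn')

/-- **Pigeonhole with a general modulus.** If `0 < m < L^t` and `m` is coprime to
`Q = ∏_{i<t} p_{i+s}`, then among the `L^t` units `∏ p_{i+s}^{e_i}` (`e_i < L`) two agree modulo
`m`, whence an abc triple with `m ∣ b`, `rad(abc)·m ≤ Q·rad(m)·c` and `c ≤ Q^L`.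
[cite: BombieriGubler2006, Prop. 12.4.12] -/
theorem exists_triple_mod {t s L m : ℕ} (hm0 : 0 < m) (hmL : m < L ^ t)
    (hcop : Nat.Coprime m (∏ i : Fin t, Nat.nth Nat.Prime (i + s))) :
    ∃ a b c : ℕ, IsABCTriple a b c ∧
      rad a b c * m ≤ (∏ i : Fin t, Nat.nth Nat.Prime (i + s)) * radical m * c ∧
      c ≤ (∏ i : Fin t, Nat.nth Nat.Prime (i + s)) ^ L ∧ m ∣ b := by
  classical
  set Q : ℕ := ∏ i : Fin t, Nat.nth Nat.Prime (i + s) with hQdef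
  have hQ0 : 0 < Q := prod_nth_prime_add_pos t s
  -- the box of exponent vectors and the pigeonhole
  set box : Finset (Fin t → ℕ) := Fintype.piFinset fun _ => Finset.range L with hbox
  have hcard : box.card = L ^ t := by
    rw [hbox, Fintype.card_piFinset, Finset.prod_const, Finset.card_range, Finset.card_univ,
      Fintype.card_fin]
  have hlt_card : (Finset.range m).card < box.card := by
    rw [Finset.card_range, hcard]; exact hmL
  have hmaps : Set.MapsTo (fun e : Fin t → ℕ => (∏ i : Fin t, Nat.nth Nat.Prime (i + s) ^ e i) % m)
      box (Finset.range m) :=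
    fun e _ => Finset.mem_coe.mpr (Finset.mem_range.mpr (Nat.mod_lt _ hm0))
  obtain ⟨e, he, e', he', hne, hmodeq⟩ :=
    Finset.exists_ne_map_eq_of_card_lt_of_maps_to hlt_card hmaps
  have hbe : ∀ i, e i ≤ L := fun i =>
    (Finset.mem_range.mp (Fintype.mem_piFinset.mp he i)).le
  have hbe' : ∀ i, e' i ≤ L := fun i =>
    (Finset.mem_range.mp (Fintype.mem_piFinset.mp he' i)).le
  have hne' : (∏ i : Fin t, Nat.nth Nat.Prime (i + s) ^ e i) ≠
      ∏ i : Fin t, Nat.nth Nat.Prime (i + s) ^ e' i :=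
    fun h => hne (prod_nth_prime_add_pow_injective t s h)
  -- order the two units
  have key : ∀ {n n' : ℕ}, n ∣ Q ^ L → n' ∣ Q ^ L → n < n' → n ≡ n' [MOD m] → 0 < n →
      ∃ a b c : ℕ, IsABCTriple a b c ∧ rad a b c * m ≤ Q * radical m * c ∧
        c ≤ Q ^ L ∧ m ∣ b := by
    intro n n' hn hn' hlt hmod hn0
    obtain ⟨a, b, c, habc, hrad, hc, hmb⟩ :=
      exists_triple_of_congruent_units_mod hcop hQ0 hm0 hn hn' hlt hmod hn0
    refine ⟨a, b, c, habc, ?_, hc, hmb⟩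
    have : b ≤ c := by obtain ⟨-, -, h, -⟩ := habc; omega
    calc rad a b c * m ≤ Q * radical m * b := hrad
      _ ≤ Q * radical m * c := Nat.mul_le_mul_left _ this
  rcases lt_or_gt_of_ne hne' with h | h
  · exact key (prod_nth_prime_add_pow_dvd e hbe) (prod_nth_prime_add_pow_dvd e' hbe') h hmodeq
      (prod_nth_prime_add_pow_pos e)
  · exact key (prod_nth_prime_add_pow_dvd e' hbe') (prod_nth_prime_add_pow_dvd e hbe) h
      (Nat.ModEq.symm hmodeq) (prod_nth_prime_add_pow_pos e')

/-! ### Polylogarithmic losses fail on every deep cell -/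

/-- **Stewart–Tijdeman inside a deep cell.** For every `K`, every natural exponent `A`, every
real `C` and every `N₀` there is an abc triple with `ω₅(abc) ≥ K`, `c ≥ N₀`, `rad(abc) < c` and
`C·rad(abc)·(log c)^A < c`.
(Units over the `t = A + 1` primes `p_{K+1}, …, p_{K+t}`, modulus `m = N^{tf}` with
`N = 2·p₀⋯p_{K−1}`, box side `L = 2N^f`: then `rad(abc) ≤ Q·N·c/N^{tf}`, `log c ≤ 2N^f log Q`, so
`C·rad·(log c)^A ≤ c · (C·Q·N·2^A (log Q)^A)/N^f`, and `N⁵ ∣ m ∣ b` puts the triple in the cell.)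
[cite: BombieriGubler2006, Prop. 12.4.12] -/
theorem deepCell_polylog_loss (K A : ℕ) (C : ℝ) (N₀ : ℕ) :
    ∃ a b c : ℕ, IsABCTriple a b c ∧
      K ≤ ((a * b * c).primeFactors.filter (fun p => 5 ≤ (a * b * c).factorization p)).card ∧
      N₀ ≤ c ∧ rad a b c < c ∧ C * (rad a b c : ℝ) * (Real.log c) ^ A < c := by
  obtain ⟨h2N, hdvdN⟩ := deepModulus_spec K
  set N : ℕ := 2 * ∏ i ∈ Finset.range K, Nat.nth Nat.Prime i with hN
  set t := A + 1 with ht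
  set s := K + 1 with hs
  set Q : ℕ := ∏ i : Fin t, Nat.nth Nat.Prime (i + s) with hQ
  have hQ0 : 0 < Q := prod_nth_prime_add_pos t s
  have hQ0R : (0 : ℝ) < Q := by exact_mod_cast hQ0
  have hQ1R : (1 : ℝ) ≤ Q := by exact_mod_cast hQ0
  have hlogQ : 0 ≤ Real.log Q := Real.log_nonneg hQ1R
  have hN1R : (1 : ℝ) < N := by exact_mod_cast (show 1 < N by omega)
  have hN0R : (0 : ℝ) < N := by linarith
  set Cp : ℝ := max C 1 with hCp
  have hCp1 : 1 ≤ Cp := le_max_right _ _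
  have hCCp : C ≤ Cp := le_max_left _ _
  have hCp0 : 0 < Cp := by linarith
  set X : ℝ := Cp * Q * N * 2 ^ A * Real.log Q ^ A with hX
  have hX0 : 0 ≤ X := by positivity
  set Y : ℝ := max (max X (Q * N)) N₀ with hY
  obtain ⟨f₀, hf₀⟩ := pow_unbounded_of_one_lt Y hN1R
  set f := f₀ + 5 with hf
  have hNf : (N : ℝ) ^ f₀ ≤ (N : ℝ) ^ f := pow_le_pow_right₀ hN1R.le (by omega)
  have hYf : Y < (N : ℝ) ^ f := lt_of_lt_of_le hf₀ hNf
  have hXf : X < (N : ℝ) ^ f := lt_of_le_of_lt (le_trans (le_max_left _ _) (le_max_left _ _)) hYf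
  have hQNf : (Q : ℝ) * N < (N : ℝ) ^ f :=
    lt_of_le_of_lt (le_trans (le_max_right _ _) (le_max_left _ _)) hYf
  have hN0f : (N₀ : ℝ) < (N : ℝ) ^ f := lt_of_le_of_lt (le_max_right _ _) hYf
  set m : ℕ := N ^ (t * f) with hm
  set L : ℕ := 2 * N ^ f with hL
  have hNpos : 0 < N := by omega
  have hm0 : 0 < m := pow_pos hNpos _
  have htf5 : 5 ≤ t * f := by
    have : 1 ≤ t := by omega
    calc 5 ≤ 1 * 5 := by norm_num
      _ ≤ t * f := Nat.mul_le_mul this (by omega)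
  have hftf : f ≤ t * f := by
    have : 1 ≤ t := by omega
    calc f = 1 * f := (one_mul f).symm
      _ ≤ t * f := Nat.mul_le_mul_right f this
  have hmL : m < L ^ t := by
    have h1 : 1 < 2 ^ t := Nat.one_lt_two_pow (by omega)
    have h2 : 0 < N ^ (t * f) := pow_pos hNpos _
    have hLt : L ^ t = 2 ^ t * N ^ (t * f) := by
      rw [hL, mul_pow 2 (N ^ f) t, ← pow_mul N f t, mul_comm f t]
    rw [hLt, hm]
    calc N ^ (t * f) = 1 * N ^ (t * f) := (one_mul _).symm
      _ < 2 ^ t * N ^ (t * f) := Nat.mul_lt_mul_of_pos_right h1 h2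
  have hcop : Nat.Coprime m Q := coprime_deepModulus_pow_prod K t (t * f)
  obtain ⟨a, b, c, habc, hrad, hc, hmb⟩ := exists_triple_mod (s := s) hm0 hmL hcop
  obtain ⟨ha0, hb0, hsum, hcopab⟩ := habc
  have hc0 : 0 < c := by omega
  have hc0R : (0 : ℝ) < c := by exact_mod_cast hc0
  have hc1R : (1 : ℝ) ≤ c := by exact_mod_cast hc0
  -- the two combinatorial bounds in ℝ
  have hradm : radical m ≤ N :=
    Literature.NumberTheory.DiophantineGeometry.radical_le_of_dvd_pow (n := t * f) hNpos.ne' dvd_rfl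
  have h1 : rad a b c * m ≤ Q * N * c :=
    calc rad a b c * m ≤ Q * radical m * c := hrad
      _ ≤ Q * N * c := by gcongr
  have h1R : (rad a b c : ℝ) * (N : ℝ) ^ (t * f) ≤ Q * N * c := by
    have : ((rad a b c * m : ℕ) : ℝ) ≤ ((Q * N * c : ℕ) : ℝ) := by exact_mod_cast h1
    push_cast [hm] at this
    exact this
  have hff : (N : ℝ) ^ f ≤ (N : ℝ) ^ (t * f) := pow_le_pow_right₀ hN1R.le hftf
  have hNf0 : (0 : ℝ) < (N : ℝ) ^ f := by positivity
  have hNtf0 : (0 : ℝ) < (N : ℝ) ^ (t * f) := by positivity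
  refine ⟨a, b, c, ⟨ha0, hb0, hsum, hcopab⟩, ?_, ?_, ?_, ?_⟩
  · -- depth: N⁵ ∣ m ∣ b ∣ abc
    have hne : a * b * c ≠ 0 := Nat.mul_ne_zero (Nat.mul_ne_zero ha0.ne' hb0.ne') hc0.ne'
    refine le_card_deep_of_dvd hne hdvdN ?_
    calc N ^ 5 ∣ m := pow_dvd_pow N htf5
      _ ∣ b := hmb
      _ ∣ a * b * c := Dvd.intro_left _ rfl |>.trans (dvd_mul_right _ _)
  · -- N₀ ≤ c: N₀ < N^f ≤ N^(tf) = m ≤ b < c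
    have hmb' : m ≤ b := Nat.le_of_dvd hb0 hmb
    have hmR : (N : ℝ) ^ (t * f) ≤ b := by
      have : ((m : ℕ) : ℝ) ≤ b := by exact_mod_cast hmb'
      push_cast [hm] at this
      exact this
    have hbc : (b : ℝ) < c := by exact_mod_cast (show b < c by omega)
    have : (N₀ : ℝ) < c := by linarith
    exact_mod_cast this.le
  · -- rad < c, from rad · N^(tf) ≤ Q · N · c and Q · N < N^f ≤ N^(tf)
    have hlt : (rad a b c : ℝ) < c := by
      by_contra hge
      have hge : (c : ℝ) ≤ rad a b c := not_lt.mp hge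
      have : (c : ℝ) * (N : ℝ) ^ f ≤ Q * N * c :=
        calc (c : ℝ) * (N : ℝ) ^ f ≤ (rad a b c : ℝ) * (N : ℝ) ^ (t * f) := by gcongr
          _ ≤ Q * N * c := h1R
      have : (N : ℝ) ^ f ≤ Q * N := by nlinarith
      linarith
    exact_mod_cast hlt
  · -- the polylog inequality
    have hradle : (rad a b c : ℝ) ≤ Q * N * c / (N : ℝ) ^ (t * f) := by
      rw [le_div_iff₀ hNtf0]; exact h1R
    have hcR : (c : ℝ) ≤ (Q : ℝ) ^ L := by exact_mod_cast hc
    have hlogc0 : 0 ≤ Real.log c := Real.log_nonneg hc1R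
    have hLR : (L : ℝ) = 2 * (N : ℝ) ^ f := by rw [hL]; push_cast; ring
    have hlogc : Real.log c ≤ 2 * (N : ℝ) ^ f * Real.log Q := by
      calc Real.log c ≤ Real.log ((Q : ℝ) ^ L) := Real.log_le_log hc0R hcR
        _ = L * Real.log Q := by rw [Real.log_pow]
        _ = 2 * (N : ℝ) ^ f * Real.log Q := by rw [hLR]
    have hpow : Real.log c ^ A ≤ (2 : ℝ) ^ A * ((N : ℝ) ^ f) ^ A * Real.log Q ^ A := by
      rw [← mul_pow, ← mul_pow]; exact pow_le_pow_left₀ hlogc0 hlogc A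
    have htf : (N : ℝ) ^ (t * f) = ((N : ℝ) ^ f) ^ A * (N : ℝ) ^ f := by
      rw [ht, ← pow_mul, ← pow_add]; congr 1; ring
    rcases le_or_gt C 0 with hC | hC
    · calc C * (rad a b c : ℝ) * Real.log c ^ A ≤ 0 :=
            mul_nonpos_of_nonpos_of_nonneg (mul_nonpos_of_nonpos_of_nonneg hC (Nat.cast_nonneg _))
              (pow_nonneg hlogc0 A)
        _ < c := hc0R
    · have hNfA0 : (0 : ℝ) < ((N : ℝ) ^ f) ^ A := by positivity
      calc C * (rad a b c : ℝ) * Real.log c ^ A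
          ≤ Cp * (rad a b c : ℝ) * Real.log c ^ A := by gcongr
        _ ≤ Cp * (Q * N * c / (N : ℝ) ^ (t * f)) *
              ((2 : ℝ) ^ A * ((N : ℝ) ^ f) ^ A * Real.log Q ^ A) := by gcongr
        _ = c * (X / (N : ℝ) ^ f) := by
            rw [hX, htf]; field_simp
        _ < c * 1 := by
            apply mul_lt_mul_of_pos_left _ hc0R
            rw [div_lt_one hNf0]; exact hXf
        _ = c := mul_one _

/-- **The `ε` of `DeepRegimeABC` cannot be weakened to any polylogarithmic loss on any deep cell.**
For every real `A` there are no `K`, `C` with `c ≤ C·rad(abc)·(log c)^A` for all abc triples with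
`ω₅(abc) ≥ K` (`^` = `Real.rpow`; the witness of `deepCell_polylog_loss` is taken with `c ≥ 3`, so
`log c ≥ 1` and `(log c)^A ≤ (log c)^⌈A⌉₊`).  The cell `K = 0` is
`Literature.Barriers.ABC.not_abc_polylog_loss'`. [cite: BombieriGubler2006, Prop. 12.4.12] -/
theorem deepRegimeABC_false_with_polylog_loss (A : ℝ) :
    ¬ ∃ K : ℕ, ∃ C : ℝ, ∀ a b c : ℕ, IsABCTriple a b c →
        K ≤ ((a * b * c).primeFactors.filter (fun p => 5 ≤ (a * b * c).factorization p)).card →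
        (c : ℝ) ≤ C * (rad a b c : ℝ) * (Real.log c) ^ A := by
  rintro ⟨K, C, hC⟩
  obtain ⟨a, b, c, habc, hK, h3c, -, hlt⟩ := deepCell_polylog_loss K ⌈A⌉₊ (max C 1) 3
  have hle := hC a b c habc hK
  have hrad0 : (0 : ℝ) ≤ (rad a b c : ℝ) := Nat.cast_nonneg _
  have hc3 : (3 : ℝ) ≤ c := by exact_mod_cast h3c
  have hlogc1 : 1 ≤ Real.log c := by
    rw [← Real.log_exp 1]
    apply Real.log_le_log (Real.exp_pos 1)
    have := Real.exp_one_lt_d9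
    linarith
  have key : Real.log c ^ A ≤ Real.log c ^ (⌈A⌉₊ : ℕ) :=
    calc Real.log c ^ A ≤ Real.log c ^ (⌈A⌉₊ : ℝ) :=
          Real.rpow_le_rpow_of_exponent_le hlogc1 (Nat.le_ceil A)
      _ = Real.log c ^ (⌈A⌉₊ : ℕ) := Real.rpow_natCast _ _
  have hpowA0 : (0 : ℝ) ≤ Real.log c ^ A := Real.rpow_nonneg (by linarith) A
  have : (c : ℝ) ≤ max C 1 * (rad a b c : ℝ) * Real.log c ^ (⌈A⌉₊ : ℕ) :=
    calc (c : ℝ) ≤ C * (rad a b c : ℝ) * Real.log c ^ A := hle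
      _ = C * ((rad a b c : ℝ) * Real.log c ^ A) := by ring
      _ ≤ max C 1 * ((rad a b c : ℝ) * Real.log c ^ A) :=
          mul_le_mul_of_nonneg_right (le_max_left _ _) (mul_nonneg hrad0 hpowA0)
      _ = max C 1 * (rad a b c : ℝ) * Real.log c ^ A := by ring
      _ ≤ max C 1 * (rad a b c : ℝ) * Real.log c ^ (⌈A⌉₊ : ℕ) := by
          have : (0 : ℝ) ≤ max C 1 * (rad a b c : ℝ) :=
            mul_nonneg (le_trans zero_le_one (le_max_right _ _)) hrad0
          exact mul_le_mul_of_nonneg_left key this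
  linarith

end Summit.ABC.ABC.Theorems.DeepRegimeABC.Negative
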